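import Summits.QuantumFields.YangMills.Theorems.FlatTubeReductionRateBudget
import Summits.QuantumFields.YangMills.Theorems.FlatTubeReductionDressedHTFixedBeta
import Summits.QuantumFields.YangMills.Theorems.FlatTubeReductionDressedTauBudget
import Summits.QuantumFields.YangMills.Theorems.FlatTubeReductionProfileDressingPackage
import HarnessLib

/-!
# THE DRESSED (B-T) BRICK `hT` OF `RateTube.AnalyticRatePotInput`, EVENTUALLY, for any admissible profile family and the dressing/normaliser of the profile package
# (route `FlatTubeReduction`, crux K1 `NearFlatRatioLaw` stmt-QuantumFields-24720; seat `ym-line-ftr-p1` g15; rate twin «ratepack-v3 / frozen fibres»; R2b1 RECORD rung — no summit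
# statement is proved here)

WHY (memo `Cruxes/NearFlatRatioLaw/Lines/ratepack-v3-frozen-g12.md` §9; NOTES T7c).  This file runs the fixed-`β` dressed brick `…DressedHTFixedBeta.dressed_hT_fixed_beta` along the
rate schedule: window `δ = D·recordDelta1 L (1/6)`, fibre radius `t = R = β^{-1/2}`, Faddeev–Popov radius `ε = btEps = β^{-1}`, `T = 9L·btR1 + btEps`, near/far threshold
`α_r = 22·β^{-1/2}√log β`, rough threshold `13δ`, quaternion core `btEps/3`, budget rate `κ₂ = β^{-1}`.  Every smallness hypothesis holds eventually (`…RateSchedule`, `…RateAlpha`),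
the budget holds eventually (`…RateBudget.eventually_dressed_budget` + `…DressedTauBudget.dressedTau_le`), the relative rate is `O(λ_b²)` (`…RateKappa`), `ε_W = O(λ_b²)` (package),
`β^{-1} = O(λ_b²)`; the window facts are those exported by `RateTube.profileDressing_package_n`.  OUTPUT: functions `c, κ : ℝ → ℝ`, `c > 0`, `0 ≤ κ = O(λ_b(L³β)²)`, and EVENTUALLY the
`hT`-inequality of `RateTube.AnalyticRatePotInput` with `σγ = c`, for every admissible test function.
* `btEps_eq_inv`, `powScale_one_le_mul_bareLambda_sq`, `fpWeight_ge_one_of_mem_gaugeCore`; ★★★ `dressed_hT_eventually`.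
HONEST FRAMING: a stub of the CONDITIONAL reduction route R2b1 (rate twin): with the package this settles the (B-T)-RATE field; (B-ST), (B-OD)-pot and the shell remain; femto rung R2b1
(RECORD label); not infinite volume, not a gap, not Clay.  No defs, no named facts, no `sorry`.
-/

set_option autoImplicit false

noncomputable section

open MeasureTheory Filter Topology Real
open scoped BigOperators Matrix Quaternion
open Literature.MathematicalPhysics.QuantumFieldTheory
open Literature.MathematicalPhysics.QuantumLattice

namespace Summit.QuantumFields.YangMills.Theorems.FemtoTransferGap.TwoLattice.ConstTube

open Summit.QuantumFields.YangMills.Theorems.FemtoTransferGap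
open Summit.QuantumFields.YangMills.Theorems.FemtoTransferGap.TwoLattice
open Summit.QuantumFields.YangMills.Theorems.FemtoTransferGap.TwoLattice.Avg
open Summit.QuantumFields.YangMills.Theorems.FemtoTransferGap.TwoLattice.Stiff (LinkSpace)
open Summit.QuantumFields.YangMills.Theorems.FemtoTransferGap.TwoLattice.Cov

variable {L : ℕ} [NeZero L]

/-! ## §1 Atoms -/

omit [NeZero L] in
/-- `btEps β = β⁻¹` for `β ≥ 1`. [folklore] -/
theorem btEps_eq_inv {β : ℝ} (hβ : 1 ≤ β) : btEps β = β⁻¹ := by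
  unfold btEps; rw [powScale_eq hβ, Real.rpow_neg_one]

/-- `β^{-1} = O(λ_b(L³β)²)`: `powScale 1 β ≤ a·bareLambda(L³β)²` for `β ≥ 1`, with `a = (|Site|/14)⁴·c_δ(1)²`. [folklore] -/
theorem powScale_one_le_mul_bareLambda_sq {β : ℝ} (hβ : 1 ≤ β) :
    powScale 1 β ≤ ((Fintype.card (Site 3 L) : ℝ) / 14) ^ 4 * ((14 * 1 / Fintype.card (Site 3 L)) ^ 2 * L / (2 : ℝ) ^ ((1 : ℝ) / 3)) ^ 2 *
      bareLambda ((L : ℝ) ^ 3 * β) ^ 2 := by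
  have hβ0 : 0 ≤ β := by linarith
  have hN : (0 : ℝ) < Fintype.card (Site 3 L) := by exact_mod_cast Fintype.card_pos
  have h4 := scaledDelta1_pow_four_eq (L := L) 1 hβ
  have e16 : powScale (1 / 6) β ^ 4 = powScale (2 / 3) β := by
    rw [powScale_eq hβ, powScale_eq hβ, ← Real.rpow_mul_natCast hβ0, show (-(1 / 6 : ℝ)) * ((4 : ℕ) : ℝ) = -(2 / 3 : ℝ) by norm_num]
  have hδ4 : (1 * recordDelta1 L (1 / 6) β) ^ 4 = (14 / Fintype.card (Site 3 L)) ^ 4 * powScale (2 / 3) β := by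
    unfold recordDelta1; rw [one_mul, div_pow, mul_pow, e16]; ring
  have h23 : powScale 1 β ≤ powScale (2 / 3) β := powScale_le_powScale (by norm_num) β
  have e : powScale (2 / 3) β = ((Fintype.card (Site 3 L) : ℝ) / 14) ^ 4 * (1 * recordDelta1 L (1 / 6) β) ^ 4 := by
    rw [hδ4]; field_simp
  rw [e, h4] at h23
  calc powScale 1 β ≤ _ := h23
    _ = _ := by ring

/-- The full FP weight is `= 1` on the quaternion core `G_c(ρ)` (`ρ < 1`, `2ρ < ε`). [folklore] -/
theorem fpWeight_ge_one_of_mem_gaugeCore {ρ ε : ℝ} (hρ1 : ρ < 1) (hρε : 2 * ρ < ε) {g : Site 3 L → SU2} (hg : g ∈ gaugeCore L ρ) : 1 ≤ fpWeight L ε g := by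
  unfold fpWeight; rw [Set.indicator_of_mem (colourMean_mem_fpBall_of_mem_gaugeCore (L := L) hρ1 hρε hg)]

/-! ## §2 ★★★ The dressed brick, eventually -/

set_option maxHeartbeats 3200000 in
/-- ★★★ **THE DRESSED (B-T) BRICK, EVENTUALLY** (see the module docstring): for an admissible profile family `Ω₀` and the normaliser/dressing data exported by
`RateTube.profileDressing_package_n` (here as hypotheses), there are `c > 0` and `0 ≤ κ = O(λ_b²)` such that EVENTUALLY, for every bounded measurable gauge-invariant `φ`
supported in the window, `|tubeForm β (boFunAd φ (n_β·Ω₀_β)) − c_β·Q_{L³β}(φW_β)| ≤ κ_β·c_β·(Q_{L³β}(φW_β) + λ₀(1,L³β)‖φ‖²)`. [cite: Luscher1983, §3] -/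
theorem dressed_hT_eventually {D : ℝ} (hD : 1 ≤ D) {Ω₀ : ℝ → LinkSpace L → ℝ}
    (hΩm : ∀ β, Measurable (Ω₀ β)) (hΩ0 : ∀ β x, 0 ≤ Ω₀ β x) (hΩ1 : ∀ β x, Ω₀ β x ≤ 1) (hΩinv : ∀ β (g : SU2) (x : LinkSpace L), Ω₀ β (adL L g x) = Ω₀ β x)
    (hΩs : ∀ β (v : Edge 3 L → Fin 3 → ℝ), Ω₀ β (linkEmbed L v) ≠ 0 →
      v ∈ capBalancedSet L ∧ ‖linkEmbed L v‖ ≤ (Real.sqrt β)⁻¹ ∧ ∀ (e : Edge 3 L) (c : Fin 3), |v e c| ≤ (Real.sqrt β)⁻¹)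
    (hθ : ∀ᶠ β : ℝ in atTop, 0 < ∫ v, Ω₀ β (linkEmbed L v) ∂orthoTransverse L)
    {n m W : ℝ → GaugeConfig 3 1 SU2 → ℝ} {εW : ℝ → ℝ} {κN CW κW : ℝ}
    (hnm : ∀ β, Measurable (n β)) (hn01 : ∀ β u, 0 ≤ n β u ∧ n β u ≤ 1) (hng : ∀ β (g : Site 3 1 → SU2) (u : GaugeConfig 3 1 SU2), n β (gaugeTransform g u) = n β u)
    (hWphys : ∀ β, IsPhys (W β)) (hW0 : ∀ β u, 0 ≤ W β u) (hWC : ∀ β u, |W β u| ≤ CW) (hκW : 0 ≤ κW) (hκN : 0 ≤ κN)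
    (hWsq : ∀ β u, orbitDist u < D * recordDelta1 L (1 / 6) β → |W β u ^ 2 - 1| ≤ κW * orbitDist u ^ 2)
    (hεW : ∃ a' : ℝ, ∀ᶠ β : ℝ in atTop, εW β ≤ a' * bareLambda ((L : ℝ) ^ 3 * β) ^ 2)
    (hwin : ∀ᶠ β : ℝ in atTop, ∀ u : GaugeConfig 3 1 SU2, orbitDist u < D * recordDelta1 L (1 / 6) β →
      |W β u ^ 2 - fpBOKernel L β (Ω₀ β) (fpWeight L β⁻¹) u u / transferKernel su2Rep ((L : ℝ) ^ 3 * β) u u /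
          (fpBOKernel L β (Ω₀ β) (fpWeight L β⁻¹) 1 1 / transferKernel su2Rep ((L : ℝ) ^ 3 * β) (1 : GaugeConfig 3 1 SU2) 1) / m β u| ≤ εW β ∧
        |m β u - 1| ≤ κN * orbitDist u ^ 2 + εW β ∧ 0 < m β u ∧ n β u ^ 2 * m β u = 1 / 2) :
    ∃ c κ : ℝ → ℝ, (∀ β, 0 < c β) ∧ (∀ β, 0 ≤ κ β) ∧ (∃ a : ℝ, ∀ᶠ β : ℝ in atTop, κ β ≤ a * bareLambda ((L : ℝ) ^ 3 * β) ^ 2) ∧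
      ∀ᶠ β : ℝ in atTop, ∀ φ : GaugeConfig 3 1 SU2 → ℝ, Measurable φ → (∃ C : ℝ, ∀ u, |φ u| ≤ C) →
        (∀ (g : Site 3 1 → SU2) (u : GaugeConfig 3 1 SU2), φ (gaugeTransform g u) = φ u) → (∀ u, φ u ≠ 0 → orbitDist u < D * recordDelta1 L (1 / 6) β) →
        |tubeForm β (RateTube.boFunAd L φ (fun u x => n β u * Ω₀ β x)) - c β * qform su2Rep ((L : ℝ) ^ 3 * β) (fun u => φ u * W β u) (fun u => φ u * W β u)| ≤
          κ β * c β * (qform su2Rep ((L : ℝ) ^ 3 * β) (fun u => φ u * W β u) (fun u => φ u * W β u) + levelValue su2Rep 1 ((L : ℝ) ^ 3 * β) 0 * l2 φ φ) := by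
  classical
  have hL1 : (1 : ℝ) ≤ L := by exact_mod_cast NeZero.one_le
  have hN0 : (0 : ℝ) < (Fintype.card (Site 3 L) : ℝ) := by exact_mod_cast Fintype.card_pos
  have hN1 : (1 : ℝ) ≤ (Fintype.card (Site 3 L) : ℝ) := by exact_mod_cast Fintype.card_pos
  have hCW0 : 0 ≤ CW := (abs_nonneg _).trans (hWC 0 1)
  have hΩ1' : ∀ β x, |Ω₀ β x| ≤ 1 := fun β x => by rw [abs_of_nonneg (hΩ0 β x)]; exact hΩ1 β x
  -- the threshold `α_r = 22·β^{-1/2}√log β`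
  have hA : (1 : ℝ) ≤ 22 := by norm_num
  have hA0 : (0 : ℝ) ≤ 22 := by norm_num
  have hAN : 48 * (3 * (Fintype.card (Site 3 L) : ℝ) + 7) ≤ (Fintype.card (Site 3 L) : ℝ) * 22 ^ 2 := by nlinarith
  have hα0ev : ∀ᶠ β : ℝ in atTop, 0 ≤ 22 * powScale (1 / 2) β * Real.sqrt (btLog β) := Eventually.of_forall fun β => alphaR_nonneg hA0 β
  have hαAev : ∀ᶠ β : ℝ in atTop, 22 * powScale (1 / 2) β * Real.sqrt (btLog β) ≤ 22 * powScale (1 / 2) β * btLog β :=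
    Eventually.of_forall fun β => alphaR_le_mul_btLog hA0 β
  have hαUev := eventually_alphaR_le_btAlpha (22 : ℝ)
  have hαLev := eventually_six_powScale_le_alphaR hA
  -- the rate constants
  obtain ⟨a₁, hκ₀ev⟩ := eventually_symKappa_le_bareLambda_sq (L := L) hD hA0 hα0ev hαAev
  obtain ⟨a', hεWa⟩ := hεW
  obtain ⟨a₂, ha₂def⟩ : ∃ a₂ : ℝ, a₂ = ((Fintype.card (Site 3 L) : ℝ) / 14) ^ 4 * ((14 * 1 / Fintype.card (Site 3 L)) ^ 2 * L / (2 : ℝ) ^ ((1 : ℝ) / 3)) ^ 2 := ⟨_, rfl⟩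
  have ha₂0 : 0 ≤ a₂ := by rw [ha₂def]; positivity
  obtain ⟨aT, haT⟩ : ∃ aT : ℝ, aT = (9 / 4 * max a₁ 0 + 5 * max a' 0) * (1 + CW ^ 2) + 2 * a₂ := ⟨_, rfl⟩
  have haT0 : 0 ≤ aT := by rw [haT]; positivity
  -- smallness of `δ`, `ε_W`
  have hδt : Tendsto (fun β : ℝ => D * recordDelta1 L (1 / 6) β) atTop (𝓝 0) := by
    simpa using (tendsto_recordDelta1 (L := L) (show (0 : ℝ) < 1 / 6 by norm_num)).const_mul D
  have hsmall := RateTube.mul_bareLambda_sq_eventually_le (L := L) (le_max_right a' 0)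
  -- ★ the fixed-`β` statement on the good set
  have main : ∀ᶠ β : ℝ in atTop, 0 < fpBOKernel L β (Ω₀ β) (fpWeight L (btEps β)) 1 1 / transferKernel su2Rep ((L : ℝ) ^ 3 * β) (1 : GaugeConfig 3 1 SU2) 1 / 2 / fpZ (btEps β) ∧
      ∀ φ : GaugeConfig 3 1 SU2 → ℝ, Measurable φ → (∃ C : ℝ, ∀ u, |φ u| ≤ C) →
        (∀ (g : Site 3 1 → SU2) (u : GaugeConfig 3 1 SU2), φ (gaugeTransform g u) = φ u) → (∀ u, φ u ≠ 0 → orbitDist u < D * recordDelta1 L (1 / 6) β) →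
        |tubeForm β (RateTube.boFunAd L φ (fun u x => n β u * Ω₀ β x)) -
            fpBOKernel L β (Ω₀ β) (fpWeight L (btEps β)) 1 1 / transferKernel su2Rep ((L : ℝ) ^ 3 * β) (1 : GaugeConfig 3 1 SU2) 1 / 2 / fpZ (btEps β) * qform su2Rep ((L : ℝ) ^ 3 * β) (fun u => φ u * W β u) (fun u => φ u * W β u)| ≤
          aT * bareLambda ((L : ℝ) ^ 3 * β) ^ 2 * (fpBOKernel L β (Ω₀ β) (fpWeight L (btEps β)) 1 1 / transferKernel su2Rep ((L : ℝ) ^ 3 * β) (1 : GaugeConfig 3 1 SU2) 1 / 2 / fpZ (btEps β)) *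
            (qform su2Rep ((L : ℝ) ^ 3 * β) (fun u => φ u * W β u) (fun u => φ u * W β u) + levelValue su2Rep 1 ((L : ℝ) ^ 3 * β) 0 * l2 φ φ) := by
    filter_upwards [eventually_rate_schedule_facts (L := L) hD, eventually_small_elementary_D (L := L) hD, eventually_alpha_elementary_D (L := L) hD hα0ev hαUev hαLev,
      eventually_coreEps_sum_le_one_D (L := L) hD, eventually_coreEta_alpha_le_one_D (L := L) hD hα0ev hαUev, eventually_symEta_alpha_le_one_D (L := L) hD hA0 hα0ev hαAev,
      eventually_dressed_budget (L := L) hD hA hAN, hκ₀ev, hεWa, hsmall, hwin, hθ,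
      eventually_mul_le_of_tendsto hδt κW (by norm_num : (0 : ℝ) < 1 / 4), eventually_mul_le_of_tendsto hδt κN (by norm_num : (0 : ℝ) < 1 / 4)]
      with β hf hel hal hεsum hηd hηs hbud hκ₀β hεWβ hsm hwinβ hθβ hκWδ hκNδ
    obtain ⟨hβ1, hℓeq, -, hreq, hεx, -, -, -, hδs, hεs, hδhalf⟩ := hf
    obtain ⟨hβ0, hδ2, -, htT, hT30, hσ2, hLa, -, -, hP, hP0, -⟩ := hel
    obtain ⟨hα1, hm₁, hm₂, hJ⟩ := hal
    obtain ⟨hB1, hB2, hρR, hκℓ, H1, H1', H2, H3⟩ := hbud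
    rw [hreq] at htT hεsum hηd hLa hm₁ hm₂ hP0 hJ H1 H1' H2
    have hx0 : 0 < powScale (1 / 2) β := powScale_pos _ _
    have hxle : powScale (1 / 2) β ≤ 1 / 30 := by have := (btRad_pos_le β).2; rw [hreq] at this; linarith
    have hε0 : 0 < btEps β := (btEps_pos_le β).1
    have hδpos : 0 < D * recordDelta1 L (1 / 6) β := by
      unfold recordDelta1; exact mul_pos (by linarith) (div_pos (mul_pos (by norm_num) (powScale_pos _ _)) hN0)
    -- support of the profile at radius `powScale (1/2) β = (√β)⁻¹`
    have hsupp : ∀ v : Edge 3 L → Fin 3 → ℝ, Ω₀ β (linkEmbed L v) ≠ 0 →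
        v ∈ capBalancedSet L ∧ (∀ (e : Edge 3 L) (c : Fin 3), |v e c| ≤ powScale (1 / 2) β) ∧ ‖linkEmbed L v‖ ≤ powScale (1 / 2) β := fun v hv => by
      obtain ⟨h1, h2, h3⟩ := hΩs β v hv
      rw [RateTube.inv_sqrt_eq_powScale_half hβ1] at h2 h3
      exact ⟨h1, h3, h2⟩
    have hsupp' : ∀ v : Edge 3 L → Fin 3 → ℝ, Ω₀ β (linkEmbed L v) ≠ 0 →
        (∀ (e : Edge 3 L) (c : Fin 3), |v e c| ≤ powScale (1 / 2) β) ∧ ‖linkEmbed L v‖ ≤ powScale (1 / 2) β := fun v hv => (hsupp v hv).2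
    -- the quaternion core `ρ = btEps/3`
    have hρ0 : 0 ≤ btEps β / 3 := by positivity
    have hρε : 2 * (btEps β / 3) < btEps β := by linarith
    have hρ1 : btEps β / 3 < 1 := by linarith [(btEps_pos_le β).2]
    -- the budget
    have hτ := dressedTau_le hβ0 hB1 hB2 (hΩm β) (hΩ1' β) (hΩ0 β) hsupp' hxle hρ0 hρR hρε hρ1 (powScale_pos 1 β).le hκℓ H1 H1' H2 H3
    -- `𝔉(1,1) > 0` from the relative floor
    have hfw := measurable_fpWeight L (btEps β)
    have ha0 : 0 < fpBOKernel L β (Ω₀ β) (fpWeight L (btEps β)) 1 1 := by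
      have hfloor := fpBOKernel_one_one_ge hβ0 (hΩm β) (hΩ1' β) (hΩ0 β) hfw (abs_fpWeight_le L (btEps β)) (fun g => (fpWeight_mem_Icc L (btEps β) g).1) hρ0 hxle
        (fun g hg => fpWeight_ge_one_of_mem_gaugeCore hρ1 hρε hg) hsupp'
      have hG : 0 < (gaugeMeasure L).real (gaugeCore L (btEps β / 3)) :=
        lt_of_lt_of_le (by positivity) (gaugeMeasure_real_gaugeCore_ge (L := L) (by positivity) hρ1.le)
      have hI : 0 < (∫ v, Ω₀ β (linkEmbed L v) ∂orthoTransverse L) ^ 2 := by positivity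
      exact lt_of_lt_of_le (mul_pos (mul_pos (Real.exp_pos _) hG) hI) hfloor
    -- the window facts at this `β`
    have hεinv : btEps β = β⁻¹ := btEps_eq_inv hβ1
    rw [← hεinv] at hwinβ
    have hεW0 : 0 ≤ εW β := by
      have h := (hwinβ 1 (by rw [show (1 : GaugeConfig 3 1 SU2) = fun _ => (1 : SU2) from rfl, orbitDist_one]; exact hδpos)).1
      exact (abs_nonneg _).trans h
    have hεW4 : εW β ≤ 1 / 4 := by
      have : a' * bareLambda ((L : ℝ) ^ 3 * β) ^ 2 ≤ max a' 0 * bareLambda ((L : ℝ) ^ 3 * β) ^ 2 := mul_le_mul_of_nonneg_right (le_max_left _ _) (sq_nonneg _)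
      linarith
    have hwin' : ∀ u : GaugeConfig 3 1 SU2, orbitDist u < D * recordDelta1 L (1 / 6) β →
        |W β u ^ 2 - fpBOKernel L β (Ω₀ β) (fpWeight L (btEps β)) u u / transferKernel su2Rep ((L : ℝ) ^ 3 * β) u u /
            (fpBOKernel L β (Ω₀ β) (fpWeight L (btEps β)) 1 1 / transferKernel su2Rep ((L : ℝ) ^ 3 * β) (1 : GaugeConfig 3 1 SU2) 1) / m β u| ≤ εW β ∧
          n β u ^ 2 * m β u = 1 / 2 ∧ |W β u ^ 2 - 1| ≤ 1 / 2 ∧ |m β u - 1| ≤ 1 / 2 := by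
      intro u hu
      obtain ⟨h1, h2, -, h4⟩ := hwinβ u hu
      have hd0 := orbitDist_nonneg u
      have hd1 : orbitDist u ^ 2 ≤ (D * recordDelta1 L (1 / 6) β) ^ 2 := pow_le_pow_left₀ hd0 hu.le 2
      have hd2 : orbitDist u ^ 2 ≤ D * recordDelta1 L (1 / 6) β := by nlinarith only [hd1, hδ2, hδpos]
      have e1 : κW * orbitDist u ^ 2 ≤ κW * (D * recordDelta1 L (1 / 6) β) := mul_le_mul_of_nonneg_left hd2 hκW
      have e2 : κN * orbitDist u ^ 2 ≤ κN * (D * recordDelta1 L (1 / 6) β) := mul_le_mul_of_nonneg_left hd2 hκN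
      refine ⟨h1, h4, (hWsq β u hu).trans ?_, h2.trans ?_⟩
      · linarith only [e1, hκWδ]
      · linarith only [e2, hκNδ, hεW4]
    -- the fixed-`β` brick
    have h := dressed_hT_fixed_beta hβ0 (hΩm β) (hΩ1' β) (hΩ0 β) (hΩinv β) hsupp hδ2 (alphaR_nonneg hA0 β) hα1 hε0 hx0.le htT hT30 hσ2 hεsum hηd hηs hLa hm₁ hm₂ hP hP0 hJ
      (hnm β) (hn01 β) (hng β) (hWphys β) (hW0 β) (hWC β) hεW0 hεW4 hwin' ha0 (powScale_pos 1 β).le hτ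
    -- `c > 0` and the uniform rate
    have hc0 : 0 < fpBOKernel L β (Ω₀ β) (fpWeight L (btEps β)) 1 1 / transferKernel su2Rep ((L : ℝ) ^ 3 * β) (1 : GaugeConfig 3 1 SU2) 1 / 2 / fpZ (btEps β) :=
      div_pos (div_pos (div_pos ha0 (transferKernel_pos _ _ _ _)) two_pos) (fpZ_pos hε0)
    have hlam2 : 0 ≤ bareLambda ((L : ℝ) ^ 3 * β) ^ 2 := sq_nonneg _
    have hy : powScale 1 β ≤ a₂ * bareLambda ((L : ℝ) ^ 3 * β) ^ 2 := by rw [ha₂def]; exact powScale_one_le_mul_bareLambda_sq (L := L) hβ1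
    have hκ₀' : _ ≤ max a₁ 0 * bareLambda ((L : ℝ) ^ 3 * β) ^ 2 := hκ₀β.trans (mul_le_mul_of_nonneg_right (le_max_left _ _) hlam2)
    have hεW' : εW β ≤ max a' 0 * bareLambda ((L : ℝ) ^ 3 * β) ^ 2 := hεWβ.trans (mul_le_mul_of_nonneg_right (le_max_left _ _) hlam2)
    refine ⟨hc0, fun φ hφm hφb hφg hs => ?_⟩
    obtain ⟨Cφ, hCφ⟩ := hφb
    have hφ := h φ hφm hCφ hφg hs
    have hq0 : 0 ≤ qform su2Rep ((L : ℝ) ^ 3 * β) (fun u => φ u * W β u) (fun u => φ u * W β u) :=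
      qform_self_nonneg_of_bounded (by positivity) (hφm.mul (hWphys β).measurable) (C := Cφ * CW) fun u => by
        rw [abs_mul]; exact mul_le_mul (hCφ u) (hWC β u) (abs_nonneg _) ((abs_nonneg _).trans (hCφ 1))
    have hS0 : 0 ≤ qform su2Rep ((L : ℝ) ^ 3 * β) (fun u => φ u * W β u) (fun u => φ u * W β u) + levelValue su2Rep 1 ((L : ℝ) ^ 3 * β) 0 * l2 φ φ := by
      have := levelValue_su2Rep_nonneg 1 (by positivity : (0 : ℝ) ≤ (L : ℝ) ^ 3 * β) 0
      have := l2_self_nonneg φ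
      positivity
    calc _ ≤ _ := hφ
      _ ≤ _ := by
        refine mul_le_mul_of_nonneg_right (mul_le_mul_of_nonneg_right ?_ hc0.le) hS0
        have h15 : 1 + 5 * εW β ≤ 9 / 4 := by linarith
        have p1 := mul_le_mul hκ₀' h15 (by linarith) (by positivity)
        have p2 := mul_le_mul_of_nonneg_right (add_le_add p1 (mul_le_mul_of_nonneg_left hεW' (by norm_num : (0 : ℝ) ≤ 5))) (by positivity : (0 : ℝ) ≤ 1 + CW ^ 2)
        rw [haT]
        linarith [p2, hy]
  -- ★ the functions `c`, `κ`
  refine ⟨fun β => if 0 < fpBOKernel L β (Ω₀ β) (fpWeight L (btEps β)) 1 1 / transferKernel su2Rep ((L : ℝ) ^ 3 * β) (1 : GaugeConfig 3 1 SU2) 1 / 2 / fpZ (btEps β) then fpBOKernel L β (Ω₀ β) (fpWeight L (btEps β)) 1 1 / transferKernel su2Rep ((L : ℝ) ^ 3 * β) (1 : GaugeConfig 3 1 SU2) 1 / 2 / fpZ (btEps β) else 1, fun β => aT * bareLambda ((L : ℝ) ^ 3 * β) ^ 2, fun β => ?_, fun β => by positivity, ⟨aT, Eventually.of_forall fun β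 => le_rfl⟩, ?_⟩
  · by_cases h : 0 < fpBOKernel L β (Ω₀ β) (fpWeight L (btEps β)) 1 1 / transferKernel su2Rep ((L : ℝ) ^ 3 * β) (1 : GaugeConfig 3 1 SU2) 1 / 2 / fpZ (btEps β)
    · simp only [if_pos h]; exact h
    · simp only [if_neg h]; exact one_pos
  · filter_upwards [main] with β hβ φ hφm hφb hφg hs
    obtain ⟨hc, hh⟩ := hβ
    simp only [if_pos hc]
    exact hh φ hφm hφb hφg hs

end Summit.QuantumFields.YangMills.Theorems.FemtoTransferGap.TwoLattice.ConstTube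

end
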